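import Literature.MathematicalPhysics.QuantumFieldTheory.Balaban1983to89.B9Eq370LetterConversion
import Literature.MathematicalPhysics.QuantumFieldTheory.Balaban1983to89.B9Ineq363L2

/-!
# `Balaban1983to89.B9Eq370LetterConversionL2` — print's (3.70)/(3.74) letter conversion «∇_U ↦ ∇_{U′U}» IN THE `L²` CURRENCY:
# the transport-defect letters as block-`ℓ²` letters, and the LEFT and RIGHT conversions composed with the (3.46) entries of any `Gp`

T. Bałaban, *Propagators for lattice gauge theories in a background field*, Commun. Math. Phys. **99** (1985) 389–434
[`Balaban1985BackgroundPropagators`, "B9"]; [4] = T. Bałaban, *Propagators and renormalization transformations for lattice gauge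
theories. II*, Commun. Math. Phys. **96** (1984) 223–250 [`Balaban1984PropagatorsII`].

statement-level skeleton of published theorems with citation tags; proofs where landed; nothing here is a claim about the
Yang–Mills mass gap

THE PRINTED LOCI.  p. 403 l.1–9 («… we can prove all the statements (3.42)–(3.47) of Theorem 3.1 for the operator G′(U′U), of course
with different constants, although changes are small»); (3.70) p. 404 (`∇_{U′U} = ∇_U + (R(U′) − 1)R(U)τ`), (3.74) p. 405 (the same for `∇*`);
Theorem 3.1 (3.46) p. 398 (the `L²` entries); [4] Prop. 2.6 (2.140)–(2.141) p. 247 (block-`ℓ²` bounds and their composition), Lemma 2.1 p. 234.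

WHY THIS FILE (pub-ymgap N06 row 13, seat dag-n06-c gen 9).  Gen 8's `B9Eq370LetterConversion` converts the (3.42) SUP entries of an
arbitrary `Gp` with difference letters at the base `U` into entries with letters at `U′U` ([4] (2.51) majorants, `B6RandomWalk.HasMajorant`) — the
`hconv` of the (3.42) member in the coded-carrier chain (`B9SectBGpTransferConvY`).  The `L²` member (3.46) of that chain (`B9SectBL2DictionaryY`:
augmented readings `KSC₃`, letters at the base) needs the SAME conversion in the block-`ℓ²` currency `B6RandomWalkL2.HasL2Majorant` of [4]
(2.140).  THIS FILE is that twin, with the same inputs in `ℓ²` shape — r06's generic carrier (sites `S`, directions `κ`, shifts `T`, background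
`U`, field `A` with `U′ = e^{iηA}` = `B9Eq39Adjoint.prodCfg`), geometry `g`, block map `blk`, real basis `b` with coordinate constant `M₂`:
* §1 ★ `hasL2Majorant_diffLetter_prodCfg_sub` — THE TRANSPORT-DEFECT LETTERS `∇♯_{U′U,k} − ∇♯_{U,k}` (`k ∈ κ ⊕ κ`) ARE BLOCK-`ℓ²` LETTERS:
  `≺₂ (4ρ²α₁ℓ(y)⁻¹)·M₂(Σ‖b_i‖)·√|ι|·e^{δd₀}·e^{−δd(y,y′)}` under (3.37) read blockwise, transports `≦ ρ`, `ηα₁ℓ⁻¹ ≦ 1/4`, the one-neighbour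
  stencil at distance `≦ d₀` (gen 8's pointwise `norm_diffLetter_prodCfg_sub_le` through g4's `B9Ineq361L2Letters.hasL2Majorant_conj_of_local`,
  multiplicity `1`: the defect reads ONE neighbour).
* §2 ★ `hasL2Majorant_diffLetter_prodCfg_mul` (LEFT): `∇♯_{U,k}·Gp ≺₂ B·ℓ·e^{−δd}` and `Gp ≺₂ B·ℓ²·e^{−δd}` ⟹ `∇♯_{U′U,k}·Gp ≺₂
  (1 + 4ρ²M₂(Σ‖b_i‖)√|ι|e^{δd₀}·α₁·Λ·c₁(β))·B·ℓ·e^{−ρd}`, `ρ + (α+β)δ₀ ≦ δ` (g4's `B9Ineq363L2.hasL2Majorant_comp_decay` ∕ `_rate_mono`);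
  ★ `hasL2Majorant_mul_diffLetter_prodCfg` (RIGHT): the same for `Gp·∇♯_{U′U,k}` with the transfer of `ℓ⁻¹` (the level-gap bookkeeping).

HONEST SCOPE.  Finite-dimensional operator algebra over r06's concrete letters; inputs and outputs are block-`ℓ²` majorants (HYPOTHESES in the shapes
the Sect.-B `L²` frames produce); no statement of Theorem 3.1 is asserted; (2.61) and the scale transfers enter as hypotheses (`Ineq261`, `ScaleTransfer`).
The second-order members (3.46)₃,₅ (two letters on the same side) are NOT converted here — they need the covariant derivative of the defect (the second
clause of (3.37)) and are the successor's.  Count-neutral bookkeeping of print's «of course with different constants»; NOT a node discharge; one finite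
lattice programme — nothing continuum, nothing about OS or the mass gap.  Cell `pub-ymgap` (HUMAN RULING D-0062), Track A node N06 [B9], row 13 (`hB`),
2026-08-28; consumer: the `L²` `hconv` of the coded-carrier chain at `KSC₃`.

RELATED IN THE TREE, NOT DUPLICATED: `B9Eq370LetterConversion` (gen 8: the sup twin, and the pointwise defect bound `norm_diffLetter_prodCfg_sub_le` —
consumed BY NAME), `B9Ineq361L2Letters` (`hasL2Majorant_conj_of_local`), `B9Ineq363L2` (`hasL2Majorant_comp_decay`, `hasL2Majorant_rate_mono`),
`B6RandomWalkL2` (`HasL2Majorant`, `hasL2Majorant_add`, `hasL2Majorant_mono`), `B9SectBL2DictionaryY` (the consumer's readings).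
-/

noncomputable section

namespace Literature.MathematicalPhysics.QuantumFieldTheory.Balaban1983to89.B9Eq370LetterConversionL2

open Literature.MathematicalPhysics.QuantumFieldTheory.Balaban1983to89
open Literature.MathematicalPhysics.QuantumFieldTheory.Balaban1983to89.B6RandomWalk (Triangle254 Ineq261)
open Literature.MathematicalPhysics.QuantumFieldTheory.Balaban1983to89.B6RandomWalkL2 (HasL2Majorant hasL2Majorant_mono hasL2Majorant_add)
open Literature.MathematicalPhysics.QuantumFieldTheory.Balaban1983to89.B9Thm34Ext (toB6)
open Literature.MathematicalPhysics.QuantumFieldTheory.Balaban1983to89.B9Ineq347 (ScaleTransfer)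
open Literature.MathematicalPhysics.QuantumFieldTheory.Balaban1983to89.B9Eq39Adjoint (prodCfg)
open Literature.MathematicalPhysics.QuantumFieldTheory.Balaban1983to89.B9Eq352DivForm (tauB)
open Literature.MathematicalPhysics.QuantumFieldTheory.Balaban1983to89.B9Eq352DivFormLetters (conj conj_sub)
open Literature.MathematicalPhysics.QuantumFieldTheory.Balaban1983to89.B9Eq352GradLetters (diffLetter)
open Literature.MathematicalPhysics.QuantumFieldTheory.Balaban1983to89.B9Ineq361L2Letters (hasL2Majorant_conj_of_local)
open Literature.MathematicalPhysics.QuantumFieldTheory.Balaban1983to89.B9Ineq363L2 (hasL2Majorant_comp_decay hasL2Majorant_rate_mono)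
open Literature.MathematicalPhysics.QuantumFieldTheory.Balaban1983to89.B9Eq370LetterConversion (norm_diffLetter_prodCfg_sub_le)

/-! ## §1  ★ The transport-defect letters as block-`ℓ²` letters -/

section Defect

variable {𝔸 : Type*} [NormedRing 𝔸] [NormedAlgebra ℂ 𝔸] [CompleteSpace 𝔸] {ι : Type} [Fintype ι] [DecidableEq ι]
variable (b : Module.Basis ι ℝ 𝔸) {S : Type} [Fintype S] [DecidableEq S] {κ : Type}
variable (T : κ → Equiv.Perm S) (U : κ → S → 𝔸ˣ)
variable {g : B9.Geometry} [Fintype g.Site] {Rr : ℝ} {H : Prop}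

/-- ★ **THE TRANSPORT-DEFECT LETTERS ARE BLOCK-`ℓ²` LETTERS**: under (3.37) blockwise (`‖A_μ(x)‖, ‖τ*_μA_μ(x)‖ ≦ α₁ℓ⁻¹`), transports `≦ ρ`,
`ηα₁ℓ⁻¹ ≦ 1/4`, the one-neighbour stencil of every `x` in blocks at `d`-distance `≦ d₀` and the coordinate constant `M₂`:
`conj b (∇♯_{U′U,k} − ∇♯_{U,k}) ≺₂ (4ρ²α₁ℓ(y)⁻¹)·M₂(Σ_i‖b_i‖)·√|ι|·e^{δd₀}·e^{−δd(y,y′)}` for every `k ∈ κ ⊕ κ` and every `δ ≧ 0` — the size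
`O(1)·α₁(Lʲη)⁻¹` of the first-order defect of (3.70)/(3.74) in the shape [4] (2.140) (multiplicity `1`: the defect reads ONE neighbour).
[cite: Balaban1985BackgroundPropagators, (3.70) p.404, (3.74) p.405, (3.37) p.396; Balaban1984PropagatorsII, Prop. 2.6 (2.140) p.247, (2.51) p.232] -/
theorem hasL2Majorant_diffLetter_prodCfg_sub (blk : S → g.Site) {η : ℝ} (hη : 0 < η) (A : κ → S → 𝔸) (ρ d₀ δ M₂ α₁ : ℝ)
    (hα₁ : 0 ≤ α₁) (hδ : 0 ≤ δ) (hM₂ : 0 ≤ M₂) (hrepr : ∀ (v : 𝔸) (i : ι), |b.repr v i| ≤ M₂ * ‖v‖)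
    (hlen : ∀ y : g.Site, 0 < g.len y) (hsmall : ∀ y : g.Site, η * (α₁ * (g.len y)⁻¹) ≤ 1 / 4)
    (hA : ∀ μ x, ‖A μ x‖ ≤ α₁ * (g.len (blk x))⁻¹ ∧ ‖tauB T U μ (A μ) x‖ ≤ α₁ * (g.len (blk x))⁻¹)
    (hρ : ∀ μ x, ‖((U μ x : 𝔸ˣ) : 𝔸)‖ ≤ ρ ∧ ‖(((U μ x)⁻¹ : 𝔸ˣ) : 𝔸)‖ ≤ ρ)
    (hd₀ : ∀ μ x, g.dist (blk x) (blk (T μ x)) ≤ d₀ ∧ g.dist (blk x) (blk ((T μ).symm x)) ≤ d₀) (k : κ ⊕ κ) :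
    HasL2Majorant (g := toB6 g Rr H) (fun p : S × ι => blk p.1)
      (conj b (diffLetter T (prodCfg U η A) (((η : ℂ))⁻¹) k - diffLetter T U (((η : ℂ))⁻¹) k))
      (fun y y' => (4 * ρ ^ 2 * M₂ * (∑ i, ‖b i‖) * Real.sqrt (Fintype.card ι) * Real.exp (δ * d₀)) * α₁ * (g.len y)⁻¹ *
        Real.exp (-(δ * g.dist y y'))) := by
  have hc0 : ∀ y : g.Site, 0 ≤ 4 * ρ ^ 2 * (α₁ * (g.len y)⁻¹) := fun y =>
    mul_nonneg (by positivity) (mul_nonneg hα₁ (inv_nonneg.mpr (hlen y).le))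
  -- the stencil: the one neighbour the defect reads
  let nb : S → S := fun x => match k with | Sum.inl μ => T μ x | Sum.inr μ => (T μ).symm x
  let near : S → S → Prop := fun x x' => x' = nb x
  have hnear : ∀ x x', near x x' → g.dist (blk x) (blk x') ≤ d₀ := by
    intro x x' hx'
    cases k with
    | inl μ => simp only [near, nb] at hx'; rw [hx']; exact (hd₀ μ x).1
    | inr μ => simp only [near, nb] at hx'; rw [hx']; exact (hd₀ μ x).2
  -- multiplicity one: the neighbour map is injective (a shift or its inverse)
  have hinj : Function.Injective nb := by
    intro x x' hxx'
    cases k with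
    | inl μ => exact (T μ).injective hxx'
    | inr μ => exact (T μ).symm.injective hxx'
  have hmult : ∀ x' : S, ∃ s : Finset S, (s.card : ℝ) ≤ (1 : ℕ) ∧ ∀ x, near x x' → x ∈ s := by
    classical
    intro x'
    refine ⟨Finset.univ.filter (fun x => nb x = x'), ?_, fun x hx => ?_⟩
    · have hle : (Finset.univ.filter (fun x => nb x = x')).card ≤ 1 := by
        refine Finset.card_le_one.2 fun x hx y hy => ?_
        rw [Finset.mem_filter] at hx hy
        exact hinj (hx.2.trans hy.2.symm)
      exact_mod_cast hle
    · rw [Finset.mem_filter]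
      exact ⟨Finset.mem_univ _, Eq.symm hx⟩
  refine hasL2Majorant_mono (g := toB6 g Rr H) _
    (hasL2Majorant_conj_of_local (Rr := Rr) (H := H) b blk near (fun y => 4 * ρ ^ 2 * (α₁ * (g.len y)⁻¹)) d₀ δ M₂ 1 hc0 hδ hM₂ hrepr hnear hmult
      (diffLetter T (prodCfg U η A) (((η : ℂ))⁻¹) k - diffLetter T U (((η : ℂ))⁻¹) k) ?_) fun y y' => le_of_eq ?_
  · intro f x B hB
    have hB' : ‖f (nb x)‖ ≤ B := hB _ rfl
    have h0 : 0 ≤ 4 * ρ ^ 2 * (α₁ * (g.len (blk x))⁻¹) := hc0 _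
    exact (norm_diffLetter_prodCfg_sub_le T U blk hη A hα₁ hlen hsmall hA hρ k f x).trans (mul_le_mul_of_nonneg_left hB' h0)
  · have h1 : Real.sqrt ((1 * Fintype.card ι : ℕ) : ℝ) = Real.sqrt (Fintype.card ι) := by rw [one_mul]
    rw [h1]; ring

end Defect

/-! ## §2  ★ The LEFT and RIGHT conversions composed with the (3.46) entries of `Gp` -/

section LeftRight

variable {𝔸 : Type*} [NormedRing 𝔸] [NormedAlgebra ℂ 𝔸] [CompleteSpace 𝔸] {ι : Type} [Fintype ι] [DecidableEq ι]
variable (b : Module.Basis ι ℝ 𝔸) {S : Type} [Fintype S] [DecidableEq S] {κ : Type}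
variable (T : κ → Equiv.Perm S) (U : κ → S → 𝔸ˣ)
variable {g : B9.Geometry} [Fintype g.Site] {Rr : ℝ} {H : Prop}

/-- ★ **THE LEFT CONVERSION IN `L²`, `∇♯_{U,k}·Gp ↦ ∇♯_{U′U,k}·Gp`** (p. 403 l.1–9 with (3.70); the (3.46) members `n = 1` (weights `w₀ = ℓ²`, `w₁ = ℓ`)
and `n = 4` applied to a right entry (`w₀ = ℓ`, `w₁ = 1`)): if `∇♯_{U,k}·Gp ≺₂ B·w₁·e^{−δd}` and `Gp ≺₂ B·w₀·e^{−δd}` with `ℓ⁻¹·w₀ ≦ w₁`, then under (3.37)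
blockwise, transports `≦ ρu`, `ηα₁ℓ⁻¹ ≦ 1/4`, the stencil geometry, the scale transfer of `w₀` at exponent `α` (constant `Λ`) and (2.61) at `β`:
`∇♯_{U′U,k}·Gp ≺₂ (1 + 4ρu²M₂(Σ‖b_i‖)√|ι|e^{δd₀}·α₁·Λ·c₁(β))·B·w₁·e^{−ρd}` for `ρ ≧ 0`, `ρ + (α+β)δ₀ ≦ δ`.
[cite: Balaban1985BackgroundPropagators, p.403 l.1–9, (3.70) p.404, (3.46) p.398; Balaban1984PropagatorsII, Prop. 2.6 (2.140)–(2.141) p.247, Lemma 2.1 p.234] -/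
theorem hasL2Majorant_diffLetter_prodCfg_mul (blk : S → g.Site) (d : ℕ) {η : ℝ} (hη : 0 < η) (A : κ → S → 𝔸)
    (ρu d₀ M₂ α₁ δ₀ δ α β ρ Λ B : ℝ) (w₀ w₁ : g.Site → ℝ) (hw₀ : ∀ a, 0 ≤ w₀ a) (hw₁ : ∀ a, 0 ≤ w₁ a) (hw : ∀ a, (g.len a)⁻¹ * w₀ a ≤ w₁ a)
    (hα₁ : 0 ≤ α₁) (hδ : 0 ≤ δ) (hM₂ : 0 ≤ M₂) (hB : 0 ≤ B) (hΛ : 0 ≤ Λ) (hρ : 0 ≤ ρ) (hr : ρ + (α + β) * δ₀ ≤ δ) (hρδ : ρ ≤ δ)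
    (hrepr : ∀ (v : 𝔸) (i : ι), |b.repr v i| ≤ M₂ * ‖v‖)
    (hdnn : ∀ a a' : g.Site, 0 ≤ g.dist a a') (htri : Triangle254 (toB6 g Rr H)) (hlen : ∀ y : g.Site, 0 < g.len y)
    (h261 : Ineq261 d (toB6 g Rr H) δ₀ β) (hT0 : ScaleTransfer g δ₀ α Λ w₀)
    (hsmall : ∀ y : g.Site, η * (α₁ * (g.len y)⁻¹) ≤ 1 / 4)
    (hA : ∀ μ x, ‖A μ x‖ ≤ α₁ * (g.len (blk x))⁻¹ ∧ ‖tauB T U μ (A μ) x‖ ≤ α₁ * (g.len (blk x))⁻¹)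
    (hρu : ∀ μ x, ‖((U μ x : 𝔸ˣ) : 𝔸)‖ ≤ ρu ∧ ‖(((U μ x)⁻¹ : 𝔸ˣ) : 𝔸)‖ ≤ ρu)
    (hd₀ : ∀ μ x, g.dist (blk x) (blk (T μ x)) ≤ d₀ ∧ g.dist (blk x) (blk ((T μ).symm x)) ≤ d₀) (k : κ ⊕ κ)
    {Gp : Module.End ℝ (S × ι → ℝ)}
    (hG : HasL2Majorant (g := toB6 g Rr H) (fun p : S × ι => blk p.1) Gp (fun a a' => B * w₀ a * Real.exp (-(δ * g.dist a a'))))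
    (hDG : HasL2Majorant (g := toB6 g Rr H) (fun p : S × ι => blk p.1) (conj b (diffLetter T U (((η : ℂ))⁻¹) k) * Gp)
      (fun a a' => B * w₁ a * Real.exp (-(δ * g.dist a a')))) :
    HasL2Majorant (g := toB6 g Rr H) (fun p : S × ι => blk p.1) (conj b (diffLetter T (prodCfg U η A) (((η : ℂ))⁻¹) k) * Gp)
      (fun a a' => ((1 + (4 * ρu ^ 2 * M₂ * (∑ i, ‖b i‖) * Real.sqrt (Fintype.card ι) * Real.exp (δ * d₀)) * α₁ * Λ * B6.c1 d δ₀ β) * B) *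
        w₁ a * Real.exp (-(ρ * g.dist a a'))) := by
  set cD : ℝ := 4 * ρu ^ 2 * M₂ * (∑ i, ‖b i‖) * Real.sqrt (Fintype.card ι) * Real.exp (δ * d₀) with hcD
  have hSb : 0 ≤ ∑ i, ‖b i‖ := Finset.sum_nonneg fun i _ => norm_nonneg _
  have hcD0 : 0 ≤ cD := by positivity
  have hc1 : 0 ≤ B6.c1 d δ₀ β := B6RandomWalk.c1_nonneg d δ₀ β
  have hwi : ∀ a : g.Site, 0 ≤ (g.len a)⁻¹ := fun a => inv_nonneg.mpr (hlen a).le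
  -- the defect letter (rate δ) composed with `Gp` (rate ρ): weight ℓ⁻¹·w₀ ≤ w₁
  have hdef := hasL2Majorant_diffLetter_prodCfg_sub b T U (Rr := Rr) (H := H) blk hη A ρu d₀ δ M₂ α₁ hα₁ hδ hM₂ hrepr hlen hsmall hA hρu hd₀ k
  have hGρ : HasL2Majorant (g := toB6 g Rr H) (fun p : S × ι => blk p.1) Gp (fun a a' => B * w₀ a * Real.exp (-(ρ * g.dist a a'))) :=
    hasL2Majorant_rate_mono (R := Rr) (H := H) _ B w₀ hB hw₀ hρδ hdnn hG
  have hcomp := hasL2Majorant_comp_decay (R := Rr) (H := H) (fun p : S × ι => blk p.1) d δ₀ α β ρ δ Λ (cD * α₁) B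
    (fun a => (g.len a)⁻¹) w₀ hwi hw₀ hΛ (mul_nonneg hcD0 hα₁) hB hρ hr hdnn htri hT0 h261
    (hasL2Majorant_mono (g := toB6 g Rr H) _ hdef fun a a' => le_of_eq (by ring)) hGρ
  -- the base letter's entry at the smaller rate
  have hDGρ : HasL2Majorant (g := toB6 g Rr H) (fun p : S × ι => blk p.1) (conj b (diffLetter T U (((η : ℂ))⁻¹) k) * Gp)
      (fun a a' => B * w₁ a * Real.exp (-(ρ * g.dist a a'))) :=
    hasL2Majorant_rate_mono (R := Rr) (H := H) _ B w₁ hB hw₁ hρδ hdnn hDG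
  -- `∇♯_{U′U,k}·Gp = ∇♯_{U,k}·Gp + (∇♯_{U′U,k} − ∇♯_{U,k})·Gp`
  have hsplit : conj b (diffLetter T (prodCfg U η A) (((η : ℂ))⁻¹) k) * Gp
      = conj b (diffLetter T U (((η : ℂ))⁻¹) k) * Gp
        + conj b (diffLetter T (prodCfg U η A) (((η : ℂ))⁻¹) k - diffLetter T U (((η : ℂ))⁻¹) k) * Gp := by
    rw [conj_sub, sub_mul, add_sub_cancel]
  rw [hsplit]
  refine hasL2Majorant_mono (g := toB6 g Rr H) _ (hasL2Majorant_add (g := toB6 g Rr H) _ hDGρ hcomp) fun a a' => ?_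
  have hex : 0 ≤ Real.exp (-(ρ * g.dist a a')) := (Real.exp_pos _).le
  have hK : 0 ≤ cD * α₁ * B * Λ * B6.c1 d δ₀ β := by positivity
  calc B * w₁ a * Real.exp (-(ρ * g.dist a a')) + cD * α₁ * B * Λ * B6.c1 d δ₀ β * ((g.len a)⁻¹ * w₀ a) * Real.exp (-(ρ * g.dist a a'))
      ≤ B * w₁ a * Real.exp (-(ρ * g.dist a a')) + cD * α₁ * B * Λ * B6.c1 d δ₀ β * w₁ a * Real.exp (-(ρ * g.dist a a')) := by
        have := mul_le_mul_of_nonneg_left (hw a) hK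
        nlinarith [mul_le_mul_of_nonneg_right this hex]
    _ = _ := by ring

/-- ★ **THE RIGHT CONVERSION IN `L²`, `Gp·∇♯_{U,k} ↦ Gp·∇♯_{U′U,k}`** (p. 403 l.1–9 with (3.74); the (3.46) member `n = 2` (weights `w₀ = ℓ²`, `w₁ = ℓ`) and
the mixed member (`Gp` a left entry: `w₀ = ℓ`, `w₁ = 1`)): if `Gp·∇♯_{U,k} ≺₂ B·w₁·e^{−δd}` and `Gp ≺₂ B·w₀·e^{−δd}` with `w₀·ℓ⁻¹ ≦ w₁`, then under (3.37)
blockwise, transports `≦ ρu`, `ηα₁ℓ⁻¹ ≦ 1/4`, the stencil geometry, the scale transfer of `ℓ⁻¹` at exponent `α` (constant `Λ` — the input-block defect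
size `α₁(L^{j′}η)⁻¹` transferred to the output block) and (2.61) at `β`: `Gp·∇♯_{U′U,k} ≺₂ (1 + 4ρu²M₂(Σ‖b_i‖)√|ι|e^{ρd₀}·α₁·Λ·c₁(β))·B·w₁·e^{−ρd}`
for `ρ ≧ 0`, `ρ + (α+β)δ₀ ≦ δ`. [cite: Balaban1985BackgroundPropagators, p.403 l.1–9, (3.74) p.405, (3.46) p.398; Balaban1984PropagatorsII, Prop. 2.6 (2.140)–(2.141) p.247, Lemma 2.1 p.234] -/
theorem hasL2Majorant_mul_diffLetter_prodCfg (blk : S → g.Site) (d : ℕ) {η : ℝ} (hη : 0 < η) (A : κ → S → 𝔸)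
    (ρu d₀ M₂ α₁ δ₀ δ α β ρ Λ B : ℝ) (w₀ w₁ : g.Site → ℝ) (hw₀ : ∀ a, 0 ≤ w₀ a) (hw₁ : ∀ a, 0 ≤ w₁ a) (hw : ∀ a, w₀ a * (g.len a)⁻¹ ≤ w₁ a)
    (hα₁ : 0 ≤ α₁) (hM₂ : 0 ≤ M₂) (hB : 0 ≤ B) (hΛ : 0 ≤ Λ) (hρ : 0 ≤ ρ) (hr : ρ + (α + β) * δ₀ ≤ δ) (hρδ : ρ ≤ δ)
    (hrepr : ∀ (v : 𝔸) (i : ι), |b.repr v i| ≤ M₂ * ‖v‖)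
    (hdnn : ∀ a a' : g.Site, 0 ≤ g.dist a a') (htri : Triangle254 (toB6 g Rr H)) (hlen : ∀ y : g.Site, 0 < g.len y)
    (h261 : Ineq261 d (toB6 g Rr H) δ₀ β) (hTi : ScaleTransfer g δ₀ α Λ (fun a => (g.len a)⁻¹))
    (hsmall : ∀ y : g.Site, η * (α₁ * (g.len y)⁻¹) ≤ 1 / 4)
    (hA : ∀ μ x, ‖A μ x‖ ≤ α₁ * (g.len (blk x))⁻¹ ∧ ‖tauB T U μ (A μ) x‖ ≤ α₁ * (g.len (blk x))⁻¹)
    (hρu : ∀ μ x, ‖((U μ x : 𝔸ˣ) : 𝔸)‖ ≤ ρu ∧ ‖(((U μ x)⁻¹ : 𝔸ˣ) : 𝔸)‖ ≤ ρu)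
    (hd₀ : ∀ μ x, g.dist (blk x) (blk (T μ x)) ≤ d₀ ∧ g.dist (blk x) (blk ((T μ).symm x)) ≤ d₀) (k : κ ⊕ κ)
    {Gp : Module.End ℝ (S × ι → ℝ)}
    (hG : HasL2Majorant (g := toB6 g Rr H) (fun p : S × ι => blk p.1) Gp (fun a a' => B * w₀ a * Real.exp (-(δ * g.dist a a'))))
    (hGD : HasL2Majorant (g := toB6 g Rr H) (fun p : S × ι => blk p.1) (Gp * conj b (diffLetter T U (((η : ℂ))⁻¹) k))
      (fun a a' => B * w₁ a * Real.exp (-(δ * g.dist a a')))) :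
    HasL2Majorant (g := toB6 g Rr H) (fun p : S × ι => blk p.1) (Gp * conj b (diffLetter T (prodCfg U η A) (((η : ℂ))⁻¹) k))
      (fun a a' => ((1 + (4 * ρu ^ 2 * M₂ * (∑ i, ‖b i‖) * Real.sqrt (Fintype.card ι) * Real.exp (ρ * d₀)) * α₁ * Λ * B6.c1 d δ₀ β) * B) *
        w₁ a * Real.exp (-(ρ * g.dist a a'))) := by
  set cD : ℝ := 4 * ρu ^ 2 * M₂ * (∑ i, ‖b i‖) * Real.sqrt (Fintype.card ι) * Real.exp (ρ * d₀) with hcD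
  have hSb : 0 ≤ ∑ i, ‖b i‖ := Finset.sum_nonneg fun i _ => norm_nonneg _
  have hcD0 : 0 ≤ cD := by positivity
  have hc1 : 0 ≤ B6.c1 d δ₀ β := B6RandomWalk.c1_nonneg d δ₀ β
  have hwi : ∀ a : g.Site, 0 ≤ (g.len a)⁻¹ := fun a => inv_nonneg.mpr (hlen a).le
  -- the defect letter at rate ρ (any rate is allowed for a local letter), `Gp` at rate δ
  have hdef := hasL2Majorant_diffLetter_prodCfg_sub b T U (Rr := Rr) (H := H) blk hη A ρu d₀ ρ M₂ α₁ hα₁ hρ hM₂ hrepr hlen hsmall hA hρu hd₀ k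
  have hcomp := hasL2Majorant_comp_decay (R := Rr) (H := H) (fun p : S × ι => blk p.1) d δ₀ α β ρ δ Λ B (cD * α₁)
    w₀ (fun a => (g.len a)⁻¹) hw₀ hwi hΛ hB (mul_nonneg hcD0 hα₁) hρ hr hdnn htri hTi h261 hG
    (hasL2Majorant_mono (g := toB6 g Rr H) _ hdef fun a a' => le_of_eq (by ring))
  have hGDρ : HasL2Majorant (g := toB6 g Rr H) (fun p : S × ι => blk p.1) (Gp * conj b (diffLetter T U (((η : ℂ))⁻¹) k))
      (fun a a' => B * w₁ a * Real.exp (-(ρ * g.dist a a'))) :=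
    hasL2Majorant_rate_mono (R := Rr) (H := H) _ B w₁ hB hw₁ hρδ hdnn hGD
  have hsplit : Gp * conj b (diffLetter T (prodCfg U η A) (((η : ℂ))⁻¹) k)
      = Gp * conj b (diffLetter T U (((η : ℂ))⁻¹) k)
        + Gp * conj b (diffLetter T (prodCfg U η A) (((η : ℂ))⁻¹) k - diffLetter T U (((η : ℂ))⁻¹) k) := by
    rw [conj_sub, mul_sub, add_sub_cancel]
  rw [hsplit]
  refine hasL2Majorant_mono (g := toB6 g Rr H) _ (hasL2Majorant_add (g := toB6 g Rr H) _ hGDρ hcomp) fun a a' => ?_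
  have hex : 0 ≤ Real.exp (-(ρ * g.dist a a')) := (Real.exp_pos _).le
  have hK : 0 ≤ B * (cD * α₁) * Λ * B6.c1 d δ₀ β := by positivity
  calc B * w₁ a * Real.exp (-(ρ * g.dist a a')) + B * (cD * α₁) * Λ * B6.c1 d δ₀ β * (w₀ a * (g.len a)⁻¹) * Real.exp (-(ρ * g.dist a a'))
      ≤ B * w₁ a * Real.exp (-(ρ * g.dist a a')) + B * (cD * α₁) * Λ * B6.c1 d δ₀ β * w₁ a * Real.exp (-(ρ * g.dist a a')) := by
        have := mul_le_mul_of_nonneg_left (hw a) hK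
        nlinarith [mul_le_mul_of_nonneg_right this hex]
    _ = _ := by ring

end LeftRight

end Literature.MathematicalPhysics.QuantumFieldTheory.Balaban1983to89.B9Eq370LetterConversionL2

end
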